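import Literature.MathematicalPhysics.QuantumFieldTheory.CentralInsertionSiteRP
import Literature.MathematicalPhysics.QuantumFieldTheory.TwistSectorOperations
import Literature.MathematicalPhysics.QuantumLattice.TwistedSectorClassicalRate
import HarnessLib

/-!
# Every 't Hooft twist sector is dominated by the periodic one: `Z_z(β) ≤ Z_{spatialPart z}(β) ≤ … ≤ Z_1(β)`
# by reflection positivity through sites, and the transposition covariance of the twisted partition function

Topic `Literature/MathematicalPhysics/QuantumFieldTheory`; theorem-only sequel of `CentralInsertionSiteRP.lean`
(namespace `InsertionSiteRP`: the Cauchy–Schwarz inequality `Z_{glue(u,v)}² ≤ Z_{glue(u,u)} Z_{glue(v,v)}` of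
reflection positivity through sites for central plaquette insertions) and `TwistSectorOperations.lean`
(namespace `MultiTwist`: `extend`, `transposeTwist`, `spatialPart`, `eraseDir`, `eraseBelow`, `temporalStacks`,
`temporalCornerValues`, the stack decomposition `plaquetteTwist_inv_eq_mul`), in the vocabulary of
`QuantumLattice/TwistedBoundaryConditions.lean` (`Twist d G`, `plaquetteTwist`, `twistedPartitionFunction`) and
`QuantumLattice/TwistedSectorClassicalRate.lean` (`TwistedSector.twistZ ρ z β L`, 't Hooft's `W{n_{μν}; a_μ}` on the
symmetric torus `(ℤ/Lℤ)^d` as a real number).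

## What is proved (everything; no facts)

For Wilson's lattice gauge theory with ANY compact gauge group `G` (Borel), ANY continuous matrix
representation `ρ`, ANY real `β`, on `(ℤ/Lℤ)^d` with `L` EVEN, and ANY 't Hooft twist `z : Plane d → Z(G)`
(centre elements of any order on any set of planes):

* `temporalStacks_mul_coboundary`, `insertedPartitionFunction_mul_temporalStacks_succ` — moving all temporal
  stacks by one time step is a central coboundary, so `Z` is unchanged (Kanazawa 2009 Lemma 1 eq. (11),
  "redefinition of variables"; tree, one plane: `stackInsertion_mul_coboundary_fst`);
* `reflectInsertion_temporalStacks_zero` (Kanazawa eq. (15) for all temporal planes at once: the reflection of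
  the stacks at `t = 0` is the inverse stacks at `t = -1`), `reflectInsertion_spatialPart` (the insertion of a
  spatial part is `Θ'`-symmetric: the site reflection carries spatial plaquettes WITHOUT reversing their
  orientation — this is what lets a magnetic background of ANY order ride along);
* ★ `insertedPartitionFunction_mul_temporalStacks_le`: `Z_{s·T} ≤ Z_s` for a `Θ'`-symmetric central background
  `s` and temporal stacks `T` at `t = 0` (Cauchy–Schwarz with `u = s`, `v = sT`; `glue(sT, sT) = s·T·T'`,
  `T'` the inverse stacks at `t = -1`, cancelling by the coboundary);
* ★ `twistZ_le_twistZ_spatialPart`: `Z_z ≤ Z_{spatialPart z}` — removing ALL temporal twists never decreases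
  `Z` ('t Hooft: `W{k, m} ≤ W{0, m}` for every electric twist `k` at fixed magnetic `m`);
* ★ `insertedWilsonAction_twist_configTranspose`, `twistZ_transposeTwist`: TRANSPOSITION COVARIANCE
  `Z_{transposeTwist μ ν z} = Z_z` (change of variables along the relabelling of the axes; the antisymmetric
  extension `ẑ` absorbs the orientation reversals — tree, one stack: `twistedPartitionFunctionAt_inv_eq_swap`);
* ★ `twistZ_le_twistZ_eraseDir` (every direction `μ`), `twistZ_le_twistZ_eraseBelow`, and
  ★★ `twistZ_le_twistZ_one` / `twistZ_le_partitionFunction` / `twistZ_div_twistZ_one_mem_Ioc` /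
  `twistedPartitionFunction_le_one_twist` (`ENNReal` form) / `sun_twistZ_le_untwisted`:
  `Z_z(β) ≤ Z_1(β)` FOR EVERY TWIST — the free energy `-log(Z_z/Z_1)` of every twist sector is `≥ 0`.

Printed sources: T. Kanazawa, Ann. Phys. 324 (2009) 1634 [Kanazawa2008] §2 Lemma 2 eq. (17)
`0 ≤ ⟨𝒪^{[k]}[𝒱]⟩ = Z^{[k]}_Λ/Z_Λ ≤ 1` — ONE vortex (one twisted plane), `SU(N)`, proved by reflection positivity
through sites (tree: `twistedPartitionFunction_le_untwisted_plane`, any compact `G`); G. 't Hooft, Nucl. Phys.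
B153 (1979) 141 [tHooft1979Flux] §2 (2.5)–(2.6): the general twist `n_{μν}` (six integers in `d = 4`) and
`W{n; a_μ}`.  The several-planes statements are this file's: the same reflection-positivity argument, the spatial
twists riding along as a symmetric background, the directions removed one at a time after a transposition.

HONEST FRAMING: finite-volume lattice statements (`L` even, symmetric torus); nothing about limits, string
tensions or the continuum.  `Z_z ≤ Z_{z'}` is proved for `z'` obtained from `z` by removing ALL twists through
one or more lattice directions — not for an arbitrary sub-twist (the reflection positivity argument needs the
surviving twists to avoid the reflected direction).

## References
* T. Kanazawa, Ann. Phys. 324 (2009) 1634–1665 (arXiv:0808.3442), §2 Lemma 1 eq. (11), Lemma 2 eqs. (15)–(17).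
  [Kanazawa2008]
* G. 't Hooft, Nucl. Phys. B153 (1979) 141–160, §2 eqs. (2.5)–(2.6). [tHooft1979Flux]
-/

open MeasureTheory Finset
open scoped BigOperators

namespace Literature.MathematicalPhysics.QuantumFieldTheory

noncomputable section

namespace MultiTwist

open WilsonRP WilsonSiteRP InsertionSiteRP QuantumLattice

/-! ## Temporal stacks: moving in time, reflecting, and the symmetric spatial background -/

section Stacks

variable {d L N : ℕ} [NeZero d] {G : Type*} [Group G]

/-- **Moving the temporal stacks by one time step is a coboundary**: the stacks at time `a` times
the plaquette coboundary of the link function `w_ν⁻¹` on the `ν`-links `{y_0 = a + 1, y_ν = b_ν}` (all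
`ν ≠ 0` at once) are the stacks at time `a' = a + 1` — Kanazawa's Lemma 1 ("redefinition of variables
`U → z^{k'} U`") / the tree's one-plane `stackInsertion_mul_coboundary_fst`, for all temporal planes
simultaneously (central values). [cite: Kanazawa2008, §2 Lemma 1 eq. (11)] -/
theorem temporalStacks_mul_coboundary [Fact (1 < L)] {w : Fin d → G}
    (hw : ∀ ν, w ν ∈ Subgroup.center G) (a a' : ZMod L) (ha : a' = a + 1) (b : Fin d → ZMod L)
    (p : Plaquette d L) :
    temporalStacks w a b p * plaquetteCoboundary
      (fun e : Edge d L => if e.2 ≠ 0 ∧ e.1 0 = a' ∧ e.1 e.2 = b e.2 then (w e.2)⁻¹ else 1) p =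
    temporalStacks w a' b p := by
  subst ha
  obtain ⟨x, ⟨⟨i, j⟩, hij⟩⟩ := p
  have hj : j ≠ 0 := fun h => by
    rw [h] at hij
    exact (Fin.not_lt_zero _) hij
  have hji : j ≠ i := (ne_of_lt hij).symm
  have hij' : i ≠ j := ne_of_lt hij
  have h10 : a ≠ a + 1 := fun h => by
    have h1 : (1 : ZMod L) = 0 := by
      calc (1 : ZMod L) = (a + 1) - a := by ring
        _ = 0 := by rw [← h, sub_self]
    exact one_ne_zero h1
  simp only [temporalStacks_apply, plaquetteCoboundary, ne_eq]
  by_cases hi : i = 0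
  · subst hi
    have hx : x 0 + 1 = a + 1 ↔ x 0 = a := add_left_inj 1
    simp only [true_and, not_true_eq_false, false_and, ↓reduceIte, one_mul, inv_one, mul_one, hj,
      not_false_eq_true, shift_apply_self, shift_apply_of_ne _ hj, shift_apply_of_ne _ (Ne.symm hj)]
    by_cases hb : x j = b j
    · by_cases h0 : x 0 = a
      · simp [hb, h0]
      · by_cases h1 : x 0 = a + 1
        · simp [hb, h1]
        · simp [hb, h0, h1]
    · simp [hb]
  · simp only [hi, false_and, ↓reduceIte, one_mul, not_false_eq_true, true_and, hj,
      shift_apply_of_ne _ hji, shift_apply_of_ne _ hij',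
      shift_apply_of_ne _ (fun h : (0 : Fin d) = i => hi h.symm),
      shift_apply_of_ne _ (fun h : (0 : Fin d) = j => hj h.symm)]
    -- the four link factors of a spatial plaquette cancel (central values)
    have hcw : ∀ (c : Prop) [Decidable c] (ν : Fin d),
        (if c then (w ν)⁻¹ else (1 : G)) ∈ Subgroup.center G := by
      intro c _ ν
      split_ifs
      exacts [Subgroup.inv_mem _ (hw ν), Subgroup.one_mem _]
    set A : G := if x 0 = a + 1 ∧ x i = b i then (w i)⁻¹ else 1 with hA
    set B : G := if x 0 = a + 1 ∧ x j = b j then (w j)⁻¹ else 1 with hB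
    have hAc : A ∈ Subgroup.center G := hcw _ i
    calc A * B * A⁻¹ * B⁻¹ = A * (B * A⁻¹) * B⁻¹ := by group
      _ = A * (A⁻¹ * B) * B⁻¹ := by rw [Subgroup.mem_center_iff.1 (Subgroup.inv_mem _ hAc) B]
      _ = 1 := by group

/-- **The reflection of the temporal stacks at time `0`** is the inverse stacks at time `-1`
(Kanazawa's `θ[𝒪^{[k]}[𝒱]] = 𝒪^{[-k]}[𝒱^θ]` for all temporal planes at once).
[cite: Kanazawa2008, §2 Lemma 2 eq. (15)] -/
theorem reflectInsertion_temporalStacks_zero (w : Fin d → G) (b : Fin d → ZMod L) :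
    reflectInsertion (temporalStacks w (0 : ZMod L) b) = temporalStacks (fun ν => (w ν)⁻¹) (-1) b := by
  funext p
  obtain ⟨x, ⟨⟨i, j⟩, hij⟩⟩ := p
  have hj : j ≠ 0 := fun h => by
    rw [h] at hij
    exact (Fin.not_lt_zero _) hij
  by_cases hi : i = 0
  · subst hi
    rw [reflectInsertion_of_eq_zero _ rfl]
    unfold sitePlaqReflect
    simp only [↓reduceIte, temporalStacks_apply, true_and, negReflect_apply_zero, shift_apply_self,
      negReflect_apply_of_ne _ hj, shift_apply_of_ne _ hj, neg_eq_zero]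
    have hx : x 0 + 1 = 0 ↔ x 0 = -1 := by
      constructor
      · intro h; linear_combination h
      · intro h; rw [h]; ring
    simp only [hx]
    split_ifs <;> simp
  · rw [reflectInsertion_of_ne_zero _ hi,
      temporalStacks_of_ne_zero _ _ _ (show (sitePlaqReflect (x, ⟨(i, j), hij⟩)).2.1.1 ≠ 0 from hi),
      temporalStacks_of_ne_zero _ _ _ (show ((x, ⟨(i, j), hij⟩) : Plaquette d L).2.1.1 ≠ 0 from hi)]

/-- On negative plaquettes the temporal stacks at time `0` are trivial (the temporal plaquettes based
at `t = 0` are positive). [folklore] -/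
private theorem temporalStacks_zero_of_neg [Fact (1 < L)] (w : Fin d → G) (b : Fin d → ZMod L)
    {p : Plaquette d L} (hp : IsSiteNegPlaq p) : temporalStacks w (0 : ZMod L) b p = 1 := by
  by_cases hi : p.2.1.1 = 0
  · refine temporalStacks_of_time_ne w b fun h0 => hp.1 ?_
    unfold IsSitePosPlaq
    rw [if_pos hi, h0, ZMod.val_zero]
    have : 1 < L := Fact.out
    omega
  · exact temporalStacks_of_ne_zero w 0 b hi

/-- Off the negative plaquettes the temporal stacks at time `-1` are trivial (the temporal plaquettes
based at `t = -1 = L - 1` are negative). [folklore] -/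
private theorem temporalStacks_negOne_of_not_neg [Fact (1 < L)] (w : Fin d → G) (b : Fin d → ZMod L)
    {p : Plaquette d L} (hp : ¬ IsSiteNegPlaq p) : temporalStacks w (-1 : ZMod L) b p = 1 := by
  by_cases hi : p.2.1.1 = 0
  · refine temporalStacks_of_time_ne w b fun h0 => hp ⟨?_, fun hs => hs.1 hi⟩
    unfold IsSitePosPlaq
    rw [if_pos hi, h0, ZMod.neg_val, if_neg one_ne_zero, ZMod.val_one]
    have : 1 < L := Fact.out
    omega
  · exact temporalStacks_of_ne_zero w _ b hi

/-- The insertion of a spatial part is invariant under the site reflection of spatial plaquettes (the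
corner condition `x_μ = x_ν = -1`, `0 < μ < ν`, does not involve the time coordinate). [cite: tHooft1979Flux, §2 eq. (2.5)] -/
theorem plaquetteTwist_spatialPart_sitePlaqReflect (z : Twist d G) (p : Plaquette d L) :
    plaquetteTwist (spatialPart z) (sitePlaqReflect p) = plaquetteTwist (spatialPart z) p := by
  by_cases hi : p.2.1.1 = 0
  · rw [plaquetteTwist_spatialPart_of_eq_zero z hi,
      plaquetteTwist_spatialPart_of_eq_zero z (show (sitePlaqReflect p).2.1.1 = 0 from hi)]
  · obtain ⟨x, ⟨⟨i, j⟩, hij⟩⟩ := p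
    have hj : j ≠ 0 := fun h => by
      rw [h] at hij
      exact (Fin.not_lt_zero _) hij
    simp only at hi
    unfold sitePlaqReflect plaquetteTwist IsCornerPlaquette
    simp only [hi, ↓reduceIte, negReflect_apply_of_ne _ hi, negReflect_apply_of_ne _ hj]

/-- **The spatial background is reflection symmetric**: `(S_z)ᶿ = S_z` for the insertion
`S_z(p) = (spatialPart z)_p⁻¹` (spatial plaquettes are carried along by `Θ'`, and the insertion vanishes
on temporal ones). [cite: Kanazawa2008, §2 Lemma 2 eq. (15)] -/
theorem reflectInsertion_spatialPart (z : Twist d G) :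
    reflectInsertion (fun p : Plaquette d L => (plaquetteTwist (spatialPart z) p)⁻¹) =
      fun p => (plaquetteTwist (spatialPart z) p)⁻¹ := by
  funext p
  by_cases hi : p.2.1.1 = 0
  · rw [reflectInsertion_of_eq_zero _ hi, plaquetteTwist_spatialPart_sitePlaqReflect,
      plaquetteTwist_spatialPart_of_eq_zero z hi, inv_one, inv_one]
  · rw [reflectInsertion_of_ne_zero _ hi, plaquetteTwist_spatialPart_sitePlaqReflect]

end Stacks

/-! ## Removing the temporal twists does not decrease the partition function -/

section Temporal

variable {d L N : ℕ} [NeZero d] [NeZero L] {G : Type*} [Group G] [TopologicalSpace G]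
  [IsTopologicalGroup G] [CompactSpace G] [MeasurableSpace G] [BorelSpace G]
  (ρ : G →* Matrix (Fin N) (Fin N) ℂ) (β : ℝ)

omit [NeZero d] in
/-- `1 < L` for an even non-zero `L`. [folklore] -/
private theorem one_lt_of_even' (hL : Even L) : 1 < L := by
  obtain ⟨r, hr⟩ := hL
  have := NeZero.ne L
  omega

/-- **Moving the temporal stacks in time does not change `Z`** (coboundary invariance,
`insertedPartitionFunction_mul_coboundary`, for all temporal planes at once; any background insertion
`s`): `Z_{s · T(a+1)} = Z_{s · T(a)}`. [cite: Kanazawa2008, §2 Lemma 1 eq. (11)] -/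
theorem insertedPartitionFunction_mul_temporalStacks_succ [Fact (1 < L)] (s : Plaquette d L → G)
    {w : Fin d → G} (hw : ∀ ν, w ν ∈ Subgroup.center G) (a a' : ZMod L) (ha : a' = a + 1)
    (b : Fin d → ZMod L) :
    insertedPartitionFunction ρ β L (fun p => s p * temporalStacks w a' b p) =
      insertedPartitionFunction ρ β L (fun p => s p * temporalStacks w a b p) := by
  have hc : ∀ e : Edge d L,
      (if e.2 ≠ 0 ∧ e.1 0 = a' ∧ e.1 e.2 = b e.2 then (w e.2)⁻¹ else (1 : G)) ∈ Subgroup.center G := by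
    intro e
    split_ifs
    exacts [Subgroup.inv_mem _ (hw _), Subgroup.one_mem _]
  rw [← insertedPartitionFunction_mul_coboundary ρ β hc (fun p => s p * temporalStacks w a b p)]
  congr 1
  funext p
  rw [mul_assoc, temporalStacks_mul_coboundary hw a a' ha b p]

/-- **Adding temporal stacks to a reflection-symmetric central background does not increase `Z`**:
`Z_{s·T} ≤ Z_s` for `sᶿ = s` central and `T` the temporal stacks at time `0` with central values — the
Cauchy–Schwarz inequality of reflection positivity through sites (`InsertionSiteRP.glue_sq_le`) with
`u = s`, `v = s·T`: `glue(s, sT) = sT`, `glue(s, s) = s`, and `glue(sT, sT) = s·T·T'` with `T'` the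
inverse stacks at time `-1`, which cancel against `T` by a coboundary (Kanazawa 2009 Lemma 2, eqs.
(16)–(17), there for one stack and trivial background). [cite: Kanazawa2008, §2 Lemma 2 eqs. (16)–(17)] -/
theorem insertedPartitionFunction_mul_temporalStacks_le (hL : Even L) (hρ : Continuous ρ)
    {s : Plaquette d L → G} (hs : ∀ p, s p ∈ Subgroup.center G) (hsymm : reflectInsertion s = s)
    {w : Fin d → G} (hw : ∀ ν, w ν ∈ Subgroup.center G) (b : Fin d → ZMod L) :
    insertedPartitionFunction ρ β L (fun p => s p * temporalStacks w 0 b p) ≤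
      insertedPartitionFunction ρ β L s := by
  haveI : Fact (1 < L) := ⟨one_lt_of_even' hL⟩
  set t : Plaquette d L → G := temporalStacks w 0 b with ht
  set t' : Plaquette d L → G := temporalStacks (fun ν => (w ν)⁻¹) (-1) b with ht'
  set v : Plaquette d L → G := fun p => s p * t p with hv
  have htc : ∀ p, t p ∈ Subgroup.center G := temporalStacks_mem_center hw 0 b
  have hvc : ∀ p, v p ∈ Subgroup.center G := fun p => Subgroup.mul_mem _ (hs p) (htc p)
  have hSh : ∀ p, IsSharedPlaq p → s p = v p := fun p hp => by
    simp only [hv, ht, temporalStacks_of_ne_zero w 0 b hp.1, mul_one]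
  -- the three glued insertions
  have hguv : glueInsertion s v = v := by
    funext p
    by_cases hp : IsSiteNegPlaq p
    · rw [glueInsertion_of_neg _ _ hp, hsymm]
      simp only [hv, ht, temporalStacks_zero_of_neg w b hp, mul_one]
    · exact glueInsertion_of_not_neg _ _ hp
  have hguu : glueInsertion s s = s := by
    funext p
    by_cases hp : IsSiteNegPlaq p
    · rw [glueInsertion_of_neg _ _ hp, hsymm]
    · exact glueInsertion_of_not_neg _ _ hp
  have hrv : reflectInsertion v = fun p => s p * t' p := by
    rw [hv, reflectInsertion_mul hs, hsymm, ht, reflectInsertion_temporalStacks_zero]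
  have hgvv : glueInsertion v v = fun p => s p * (t p * t' p) := by
    funext p
    by_cases hp : IsSiteNegPlaq p
    · rw [glueInsertion_of_neg _ _ hp, hrv]
      simp only [ht, temporalStacks_zero_of_neg w b hp, one_mul]
    · rw [glueInsertion_of_not_neg _ _ hp]
      simp only [hv, ht', temporalStacks_negOne_of_not_neg _ b hp, mul_one]
  -- `T · T'` is a coboundary: `Z_{s T T'} = Z_s`
  have hcancel : insertedPartitionFunction ρ β L (fun p => s p * (t p * t' p)) =
      insertedPartitionFunction ρ β L s := by
    have hc : ∀ e : Edge d L,
        (if e.2 ≠ 0 ∧ e.1 0 = (0 : ZMod L) ∧ e.1 e.2 = b e.2 then (w e.2)⁻¹ else (1 : G)) ∈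
          Subgroup.center G := by
      intro e
      split_ifs
      exacts [Subgroup.inv_mem _ (hw _), Subgroup.one_mem _]
    rw [← insertedPartitionFunction_mul_coboundary ρ β hc s]
    congr 1
    funext p
    congr 1
    have hm := temporalStacks_mul_coboundary hw (-1) 0 (by ring) b p
    have hT' : t' p = (temporalStacks w (-1) b p)⁻¹ := by
      simp only [ht', temporalStacks_inv]
    have hcT : temporalStacks w (-1) b p ∈ Subgroup.center G := temporalStacks_mem_center hw _ b p
    rw [hT', ht, ← hm, ← Subgroup.mem_center_iff.1 hcT, mul_inv_cancel_right]
  -- Cauchy–Schwarz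
  have hCS := glue_sq_le ρ hL hρ β hs hvc hSh
  rw [hguv, hguu, hgvv, hcancel] at hCS
  have h1 : 0 < insertedPartitionFunction ρ β L v := insertedPartitionFunction_pos ρ hρ β v
  have h2 : 0 < insertedPartitionFunction ρ β L s := insertedPartitionFunction_pos ρ hρ β s
  nlinarith [hCS, h1, h2]

/-- ★ **Removing all temporal twists does not decrease the twisted partition function**:
`Z_z(β) ≤ Z_{spatialPart z}(β)` for EVERY 't Hooft twist `z` (any compact `G`, central values of any
order, any continuous `ρ`, any real `β`, `L` even) — 't Hooft's `W{k, m; a_μ} ≤ W{0, m; a_μ}`, the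
magnetic background `m` riding along because the site reflection carries the spatial plaquettes without
reversing their orientation.  One temporal plane and trivial background: Kanazawa 2009, Lemma 2,
eq. (17) `⟨𝒪^{[k]}[𝒱]⟩ ≤ 1` (tree: `twistedPartitionFunction_le_untwisted`).
[cite: Kanazawa2008, §2 Lemma 2 eq. (17)] [cite: tHooft1979Flux, §2 eqs. (2.5)–(2.6)] -/
theorem twistZ_le_twistZ_spatialPart (hL : Even L) (hρ : Continuous ρ) (z : Twist d G) :
    TwistedSector.twistZ ρ z β L ≤ TwistedSector.twistZ ρ (spatialPart z) β L := by
  haveI : Fact (1 < L) := ⟨one_lt_of_even' hL⟩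
  unfold TwistedSector.twistZ
  have hins : (fun p : Plaquette d L => (plaquetteTwist z p)⁻¹) = fun p =>
      (plaquetteTwist (spatialPart z) p)⁻¹ *
        temporalStacks (temporalCornerValues z) (-1) (fun _ => -1) p :=
    funext (plaquetteTwist_inv_eq_mul z)
  rw [hins, ← insertedPartitionFunction_mul_temporalStacks_succ ρ β _ (temporalCornerValues_mem_center z)
    (-1) 0 (by ring) (fun _ => -1)]
  exact insertedPartitionFunction_mul_temporalStacks_le ρ β hL hρ (plaquetteTwist_inv_mem_center _)
    (reflectInsertion_spatialPart z) (temporalCornerValues_mem_center z) _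

end Temporal

/-! ## Transposition covariance of the twisted partition function -/

section Transpose

variable {d L N : ℕ} [NeZero L] {G : Type*} [Group G] [TopologicalSpace G] [IsTopologicalGroup G]
  [CompactSpace G] (ρ : G →* Matrix (Fin N) (Fin N) ℂ)

omit [NeZero L] [TopologicalSpace G] [IsTopologicalGroup G] [CompactSpace G] in
/-- Reversing the orientation of a plaquette inverts its holonomy. [folklore] -/
private theorem plaquetteHolonomy_reverse' (U : GaugeConfig d L G) (x : Site d L) (i j : Fin d) :
    plaquetteHolonomy U x j i = (plaquetteHolonomy U x i j)⁻¹ := by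
  simp only [plaquetteHolonomy, mul_inv_rev, inv_inv, mul_assoc]

/-- **The twisted action under a transposition of axes**: relabelling the link variables along
`μ ↔ ν` turns the action twisted by `z` into the action twisted by `transposeTwist μ ν z` (the planes
whose orientation is reversed by the relabelling carry the inverse twist: 't Hooft's tensor is
antisymmetric).  One stack: the tree's `insertedWilsonAction_inv_configTranspose`.
[cite: tHooft1979Flux, §2 eqs. (2.5)–(2.6)] -/
theorem insertedWilsonAction_twist_configTranspose (hρ : Continuous ρ) (μ ν : Fin d) (z : Twist d G)
    (U : GaugeConfig d L G) :
    insertedWilsonAction ρ (fun p => (plaquetteTwist z p)⁻¹) (configTranspose μ ν U) =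
      insertedWilsonAction ρ (fun p => (plaquetteTwist (transposeTwist μ ν z) p)⁻¹) U := by
  -- the antisymmetric insertion of the transposed twist on ordered pairs of directions
  set o : Site d L → Fin d → Fin d → G := fun y k l =>
    if y k = -1 ∧ y l = -1 then (((extend (transposeTwist μ ν z) k l : Subgroup.center G) : G))⁻¹ else 1
    with ho
  set f : Site d L → Fin d → Fin d → ℝ := fun y k l =>
    (N : ℝ) - (ρ (o y k l * plaquetteHolonomy U y k l)).trace.re with hf
  have hosymm : ∀ y k l, o y l k = (o y k l)⁻¹ := by
    intro y k l
    simp only [ho]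
    by_cases h : y k = -1 ∧ y l = -1
    · rw [if_pos h, if_pos ⟨h.2, h.1⟩, extend_swap, inv_inv]
      simp
    · rw [if_neg h, if_neg (fun h' => h ⟨h'.2, h'.1⟩), inv_one]
  have hfsymm : ∀ y k l, f y k l = f y l k := by
    intro y k l
    simp only [hf]
    rw [hosymm y k l, plaquetteHolonomy_reverse' U y k l, re_trace_inv_mul_inv ρ hρ]
  -- the `z`-insertion read in transposed coordinates is the `o`-insertion
  have hoz : ∀ p : Plaquette d L, (plaquetteTwist z p)⁻¹ =
      o (siteTranspose μ ν p.1) (Equiv.swap μ ν p.2.1.1) (Equiv.swap μ ν p.2.1.2) := by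
    intro p
    simp only [ho, siteTranspose, Equiv.swap_apply_self, extend_transposeTwist,
      plaquetteTwist_eq_extend]
    split_ifs <;> simp
  calc insertedWilsonAction ρ (fun p => (plaquetteTwist z p)⁻¹) (configTranspose μ ν U)
      = ∑ p : Plaquette d L, f (siteTranspose μ ν p.1) (Equiv.swap μ ν p.2.1.1)
          (Equiv.swap μ ν p.2.1.2) := by
        unfold insertedWilsonAction
        refine Finset.sum_congr rfl fun p _ => ?_
        simp only [hf]
        rw [plaquetteHolonomy_configTranspose, hoz]
    _ = ∑ p : Plaquette d L, f p.1 p.2.1.1 p.2.1.2 := sum_plaquette_transpose f hfsymm μ ν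
    _ = insertedWilsonAction ρ (fun p => (plaquetteTwist (transposeTwist μ ν z) p)⁻¹) U := by
        unfold insertedWilsonAction
        refine Finset.sum_congr rfl fun p _ => ?_
        simp only [hf, ho, plaquetteTwist_eq_extend]
        congr 4
        split_ifs <;> simp

variable [MeasurableSpace G] [BorelSpace G] (β : ℝ)

/-- ★ **Transposition covariance of 't Hooft's twisted partition function**:
`Z_{transposeTwist μ ν z}(β) = Z_z(β)` — relabelling the axes is a measure-preserving change of
variables (`measurePreserving_configTransposeEquiv`); one plane: the tree's
`twistedPartitionFunctionAt_inv_eq_swap`. [cite: tHooft1979Flux, §2 eqs. (2.5)–(2.6)] -/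
theorem twistZ_transposeTwist (hρ : Continuous ρ) (μ ν : Fin d) (z : Twist d G) :
    TwistedSector.twistZ ρ (transposeTwist μ ν z) β L = TwistedSector.twistZ ρ z β L := by
  unfold TwistedSector.twistZ insertedPartitionFunction
  symm
  calc ∫ U : GaugeConfig d L G, Real.exp (-(β * insertedWilsonAction ρ
          (fun p => (plaquetteTwist z p)⁻¹) U)) ∂(Measure.pi fun _ : Edge d L => haarProbability G)
      = ∫ U : GaugeConfig d L G, Real.exp (-(β * insertedWilsonAction ρ
          (fun p => (plaquetteTwist z p)⁻¹) (configTransposeEquiv μ ν U)))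
          ∂(Measure.pi fun _ : Edge d L => haarProbability G) :=
        ((measurePreserving_configTransposeEquiv μ ν).integral_comp'
          (fun V : GaugeConfig d L G => Real.exp (-(β * insertedWilsonAction ρ
            (fun p => (plaquetteTwist z p)⁻¹) V)))).symm
    _ = ∫ U : GaugeConfig d L G, Real.exp (-(β * insertedWilsonAction ρ
          (fun p => (plaquetteTwist (transposeTwist μ ν z) p)⁻¹) U))
          ∂(Measure.pi fun _ : Edge d L => haarProbability G) := by
        simp only [configTransposeEquiv_apply, insertedWilsonAction_twist_configTranspose ρ hρ μ ν z]

end Transpose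

/-! ## Removing the twists through any direction; the untwisted partition function dominates -/

section Monotone

variable {d L N : ℕ} [NeZero d] [NeZero L] {G : Type*} [Group G] [TopologicalSpace G]
  [IsTopologicalGroup G] [CompactSpace G] [MeasurableSpace G] [BorelSpace G]
  (ρ : G →* Matrix (Fin N) (Fin N) ℂ) (β : ℝ)

/-- ★ **Removing all twists through one lattice direction does not decrease `Z`**:
`Z_z(β) ≤ Z_{eraseDir μ z}(β)` for every direction `μ` and every twist `z` (transpose `0 ↔ μ`, remove
the temporal twists, transpose back). [cite: Kanazawa2008, §2 Lemma 2 eq. (17)] [cite: tHooft1979Flux, §2 eqs. (2.5)–(2.6)] -/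
theorem twistZ_le_twistZ_eraseDir (hL : Even L) (hρ : Continuous ρ) (μ : Fin d) (z : Twist d G) :
    TwistedSector.twistZ ρ z β L ≤ TwistedSector.twistZ ρ (eraseDir μ z) β L := by
  have h1 : TwistedSector.twistZ ρ z β L = TwistedSector.twistZ ρ (transposeTwist 0 μ z) β L :=
    (twistZ_transposeTwist ρ β hρ 0 μ z).symm
  have h2 := twistZ_le_twistZ_spatialPart ρ β hL hρ (transposeTwist 0 μ z)
  have h3 : TwistedSector.twistZ ρ (spatialPart (transposeTwist 0 μ z)) β L =
      TwistedSector.twistZ ρ (eraseDir μ z) β L := by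
    rw [← transposeTwist_eraseDir_zero_transposeTwist μ z, twistZ_transposeTwist ρ β hρ, eraseDir_zero]
  rw [h1, ← h3]
  exact h2

/-- Stage by stage: `Z_z ≤ Z_{eraseBelow m z}` for `m ≤ d`. [cite: Kanazawa2008, §2 Lemma 2 eq. (17)] -/
theorem twistZ_le_twistZ_eraseBelow (hL : Even L) (hρ : Continuous ρ) (z : Twist d G) {m : ℕ}
    (hm : m ≤ d) : TwistedSector.twistZ ρ z β L ≤ TwistedSector.twistZ ρ (eraseBelow m z) β L := by
  induction m with
  | zero => rw [eraseBelow_zero]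
  | succ m ih =>
    have hm' : m < d := hm
    calc TwistedSector.twistZ ρ z β L ≤ TwistedSector.twistZ ρ (eraseBelow m z) β L := ih hm'.le
      _ ≤ TwistedSector.twistZ ρ (eraseDir ⟨m, hm'⟩ (eraseBelow m z)) β L :=
          twistZ_le_twistZ_eraseDir ρ β hL hρ _ _
      _ = TwistedSector.twistZ ρ (eraseBelow (m + 1) z) β L := by rw [eraseBelow_succ hm']

/-- ★★ **The untwisted partition function dominates every twist sector**: `Z_z(β) ≤ Z_1(β)` for
EVERY 't Hooft twist `z : Plane d → Z(G)` — any compact `G`, any continuous `ρ`, any real `β`, `L`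
even, any `d ≥ 1`; i.e. the free energy `-log(Z_z/Z_1)` of every twist sector is non-negative.  One
twisted plane: Kanazawa 2009 Lemma 2 eq. (17) (`SU(N)`), the tree's
`twistedPartitionFunction_le_untwisted_plane`; several planes: this file (remove the twists direction by
direction). [cite: Kanazawa2008, §2 Lemma 2 eq. (17)] [cite: tHooft1979Flux, §2 eqs. (2.5)–(2.6)] -/
theorem twistZ_le_twistZ_one (hL : Even L) (hρ : Continuous ρ) (z : Twist d G) :
    TwistedSector.twistZ ρ z β L ≤ TwistedSector.twistZ ρ (1 : Twist d G) β L := by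
  have h := twistZ_le_twistZ_eraseBelow ρ β hL hρ z (Nat.sub_le d 1)
  rwa [eraseBelow_pred] at h

omit [NeZero d] in
/-- `Z_1(β)` is the (real number underlying the) Wilson partition function.
[cite: tHooft1979Flux, §2 eq. (2.6)] -/
theorem twistZ_one_eq (hρ : Continuous ρ) :
    TwistedSector.twistZ ρ (1 : Twist d G) β L = (partitionFunction (d := d) (L := L) ρ β).toReal := by
  unfold TwistedSector.twistZ
  rw [← insertedPartitionFunction_one ρ hρ β]
  congr 1
  funext p
  rw [plaquetteTwist_one, inv_one]

/-- ★★ `Z_z(β) ≤ Z(β)`: every twist sector is dominated by the periodic partition function.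
[cite: Kanazawa2008, §2 Lemma 2 eq. (17)] [cite: tHooft1979Flux, §2 eqs. (2.5)–(2.6)] -/
theorem twistZ_le_partitionFunction (hL : Even L) (hρ : Continuous ρ) (z : Twist d G) :
    TwistedSector.twistZ ρ z β L ≤ (partitionFunction (d := d) (L := L) ρ β).toReal := by
  rw [← twistZ_one_eq ρ β hρ]
  exact twistZ_le_twistZ_one ρ β hL hρ z

/-- The ratio `Z_z/Z_1 ∈ (0, 1]` for every twist. [cite: Kanazawa2008, §2 Lemma 2 eq. (17)] -/
theorem twistZ_div_twistZ_one_mem_Ioc (hL : Even L) (hρ : Continuous ρ) (z : Twist d G) :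
    TwistedSector.twistZ ρ z β L / TwistedSector.twistZ ρ (1 : Twist d G) β L ∈ Set.Ioc (0 : ℝ) 1 := by
  have h1 := TwistedSector.twistZ_pos ρ hρ (1 : Twist d G) β L
  exact ⟨div_pos (TwistedSector.twistZ_pos ρ hρ z β L) h1,
    (div_le_one h1).2 (twistZ_le_twistZ_one ρ β hL hρ z)⟩

/-- ★★ The `ENNReal` form: `twistedPartitionFunction ρ z β ≤ twistedPartitionFunction ρ 1 β` (the
tree's twisted partition function of `QuantumLattice/TwistedBoundaryConditions.lean`), every twist.
[cite: Kanazawa2008, §2 Lemma 2 eq. (17)] [cite: tHooft1979Flux, §2 eqs. (2.5)–(2.6)] -/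
theorem twistedPartitionFunction_le_one_twist (hL : Even L) (hρ : Continuous ρ) (z : Twist d G) :
    QuantumLattice.twistedPartitionFunction (L := L) ρ z β ≤
      QuantumLattice.twistedPartitionFunction (L := L) ρ (1 : Twist d G) β := by
  have hz := TwistedSector.toReal_twistedPartitionFunction ρ hρ z β L
  have h1 := TwistedSector.toReal_twistedPartitionFunction ρ hρ (1 : Twist d G) β L
  have hzt : QuantumLattice.twistedPartitionFunction (L := L) ρ z β ≠ ⊤ := fun h => by
    rw [h, ENNReal.toReal_top] at hz
    exact (TwistedSector.twistZ_pos ρ hρ z β L).ne hz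
  have h1t : QuantumLattice.twistedPartitionFunction (L := L) ρ (1 : Twist d G) β ≠ ⊤ := fun h => by
    rw [h, ENNReal.toReal_top] at h1
    exact (TwistedSector.twistZ_pos ρ hρ (1 : Twist d G) β L).ne h1
  rw [← ENNReal.toReal_le_toReal hzt h1t, hz, h1]
  exact twistZ_le_twistZ_one ρ β hL hρ z

/-- ★★ `SU(N)`, every twist tensor `n_{μν} ∈ ℤ/N` on every plane ('t Hooft's `W{n; a_μ}` with all six
`n_{μν}` arbitrary in `d = 4`): `W{n} ≤ W{0}`. [cite: tHooft1979Flux, §2 eqs. (2.5)–(2.6)] [cite: Kanazawa2008, §2 Lemma 2 eq. (17)] -/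
theorem sun_twistZ_le_untwisted (hL : Even L) (Ncol : ℕ) (β : ℝ) (n : Plane d → ZMod Ncol) :
    TwistedSector.twistZ (fundamentalRep (Fin Ncol)) (twistOfTensor Ncol n) β L ≤
      TwistedSector.twistZ (fundamentalRep (Fin Ncol)) (1 : Twist d (Matrix.specialUnitaryGroup (Fin Ncol) ℂ)) β L :=
  twistZ_le_twistZ_one _ β hL (continuous_fundamentalRep (Fin Ncol)) _

end Monotone

end MultiTwist

end

end Literature.MathematicalPhysics.QuantumFieldTheory
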